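import Literature.Geometry.Riemannian.BishopGromovDirectional
import Literature.Geometry.Riemannian.VolumeSphereTheoremReifenbergProofs
import HarnessLib

/-!
# Bishop's volume bounds for balls under `Ric ≥ -(d-1)` and `Ric ≥ 0`, and null distance spheres

Continuing `BishopGromovRelativeVolume.lean` / `BishopGromovDirectional.lean` (exponential polar
coordinates `F = exp_p ∘ L`, the polar density `𝟙_W 𝒥`, the relative comparison (0.5) and
(A.2.2) of Cheeger–Colding 1997), this file PROVES the ABSOLUTE half of the classical volume
comparison and a regularity property of distance balls used throughout the comparison geometry of
the paper (§1, (1.2)–(1.5); Thm. 1.6):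

* `riemannianMeasure_ball_le_of_ricci_ge_neg` — **Bishop's theorem** (Chavel 2006, Thm. III.4.4
  "(R. L. Bishop (1964))", (III.4.21) `V(x; r) ≤ V_κ(r)`, `κ = -1`): on a connected Riemannian
  `d`-manifold with geodesically complete Levi-Civita connection and `Ric ≥ -(d-1) g`,
  `Vol {d(p,·) < r} ≤ |S^{d-1}| ∫₀ʳ sinh^{d-1}`, the volume of the ball of radius `r` in
  hyperbolic `d`-space;
* `riemannianMeasure_ball_le_of_ricci_nonneg` — the same with `Ric ≥ 0` and the Euclidean bound
  `|S^{d-1}| rᵈ/d`;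
* `riemannianMeasure_sphere_eq_zero`, `riemannianMeasure_closedBall_eq_ball` — distance spheres
  `{d(p,·) = r}` are null, so closed and open distance balls have the same volume (any connected
  manifold with complete Levi-Civita connection; no curvature hypothesis);
* `riemannianMeasure_ball_mul_le_of_ricci_ge_neg_of_edist_le`,
  `riemannianMeasure_ball_le_ball_of_edist_le` — the TWO-CENTRE comparisons (1.2)–(1.4) of
  Cheeger–Colding 1997, §1 (p. 415): for `d(x₁, x₂) ≤ s`, `Vol B_{r₂}(x₂) V(r₁) ≤ Vol B_{r₁}(x₁)
  V(r₂ + s)` (`0 < r₁ ≤ r₂ + s`) and `Vol B_{r₁}(x₁) ≤ Vol B_{r₂}(x₂)` (`r₁ + s ≤ r₂`);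
* `measureReal_ball_mul_le_of_ricci_ge_neg_of_complete` — (0.5) in the real-valued metric-measure
  form `μ(B_ρ) V(r) ≤ μ(B_r) V(ρ)` on `(M, d_g, vol_g)` for COMPLETE manifolds (balls have finite
  volume by Bishop), and `exists_finset_cover_ball_of_ricci_ge_neg` — **the standard covering
  argument based on (0.5)** (Cheeger–Colding 1997, §1, p. 417): every `B_R(x)` is covered by the
  `ε`-balls of an `ε`-separated set `S ⊆ B_R(x)` with `#S ≤ V(2R + ε/2)/V(ε/2)`,
  `V(ρ) = ∫₀^ρ sinh^{d-1}` (the abstract lemma `exists_finset_cover_ball_of_relVolumeComparison`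
  of `VolumeSphereTheoremReifenbergProofs.lean` §R4 fed with (0.5), finiteness and positivity).

Proofs: per ray, Bishop's inequality (III.4.13) `det 𝒜(t) ≤ sinh^{d-1} t` (resp. `≤ t^{d-1}`)
from the matrix Riccati comparison layer (`jacobi_det_le_sinh_pow`, `jacobi_det_le_pow` of
`VolumeSphereTheoremProofs.lean` §8) read through `exists_jacobi_sqrt_det_gram_expMap_ray`
(`indicator_jacobian_mul_pow_le_sinh_pow`, `indicator_jacobian_le_one`), then the polar formula
`riemannianMeasure_ball_eq_setLIntegral_indicator` and `|S^{d-1}| = volume.toSphere(S^{d-1})`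
(`toSphere_volume_univ`); for spheres, the polar representation of points (`expPolar_data`) covers
`{d(p,·) = r}` by `F(W ∩ {|x| = r}) ∪ F(N)` with `{|x| = r}` Lebesgue-null
(`Measure.addHaar_sphere`) and `F(N)` null. (The tree's `BishopVolumeComparison.lean` has the
closed-ball bound for `Ric ≥ d-1` by the area inequality; here the `κ = -1, 0` cases follow from
the exact polar formula.)

No definitions and no named facts are introduced (D-0026).

## References

* I. Chavel, *Riemannian Geometry: A Modern Introduction*, 2nd ed., CUP 2006, §III.3 ((III.3.5)),
  §III.4, Thm. III.4.3 ((III.4.13)), Thm. III.4.4 ((III.4.21)). [Chavel2006]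
* J. Cheeger, T. H. Colding, *On the structure of spaces with Ricci curvature bounded below. I*,
  J. Differential Geom. 46 (1997) 406–480, (0.5) (p. 410), §1 (pp. 415–417: (1.2)–(1.4), (1.14)–(1.18)).
  [CheegerColding1997]
-/

noncomputable section

open Bundle Set Function Filter MeasureTheory Manifold
open scoped Manifold ContDiff Topology ENNReal NNReal

namespace Literature.Geometry.Riemannian

open Lorentzian Lorentzian.PseudoRiemannianMetric

/-! ### Bishop's absolute bounds for balls and null distance spheres -/

section BallBounds

variable {d : ℕ} {M : Type*} [TopologicalSpace M] [ChartedSpace (EuclideanSpace ℝ (Fin d)) M]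
  [IsManifold 𝓘(ℝ, EuclideanSpace ℝ (Fin d)) ∞ M] [T2Space M]
  (g : PseudoRiemannianMetric 𝓘(ℝ, EuclideanSpace ℝ (Fin d)) ∞ (EuclideanSpace ℝ (Fin d))
    (TangentSpace 𝓘(ℝ, EuclideanSpace ℝ (Fin d)) : M → Type _)) [g.HasLeviCivita]
  [CovariantDerivative.ContMDiffCovariantDerivative g.leviCivita 1]
  [CovariantDerivative.ContMDiffCovariantDerivative g.leviCivita ∞]

/-- `det 𝒜 ≤ sinh^{n-1}` on `(0, b)` also for an empty index type (`1 ≤ 1`):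
`jacobi_det_le_sinh_pow` without the `Nonempty` hypothesis, for `det 𝒜 > 0`.
[cite: Chavel2006, Thm. III.4.3 (III.4.13)] -/
theorem jacobi_det_le_sinh_pow' {ι : Type*} [Fintype ι] [DecidableEq ι]
    {A A' R : ℝ → Matrix ι ι ℝ} {a b : ℝ} (h0 : (0 : ℝ) ∈ Ioo a b)
    (hA : ∀ t ∈ Ioo a b, HasDerivAt A (A' t) t)
    (hA' : ∀ t ∈ Ioo a b, HasDerivAt A' (-(R t * A t)) t)
    (hR : ∀ t ∈ Ioo a b, (R t).IsSymm) (hRc : ContinuousAt R 0)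
    (hA0 : A 0 = 0) (hA'0 : A' 0 = 1)
    (hdet : ∀ t ∈ Ioo 0 b, (A t).det ≠ 0)
    (hRic : ∀ t ∈ Ioo 0 b, -(Fintype.card ι : ℝ) ≤ (R t).trace) :
    ∀ t ∈ Ioo 0 b, (A t).det ≤ Real.sinh t ^ Fintype.card ι := by
  rcases isEmpty_or_nonempty ι with hι | hι
  · intro t _
    simp [Matrix.det_isEmpty]
  · exact jacobi_det_le_sinh_pow h0 hA hA' hR hRc hA0 hA'0 hdet hRic

/-- `det 𝒜 ≤ t^{n-1}` on `(0, b)` also for an empty index type: `jacobi_det_le_pow` without the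
`Nonempty` hypothesis. [cite: Chavel2006, Thm. III.4.3 (III.4.13)] -/
theorem jacobi_det_le_pow' {ι : Type*} [Fintype ι] [DecidableEq ι]
    {A A' R : ℝ → Matrix ι ι ℝ} {a b : ℝ} (h0 : (0 : ℝ) ∈ Ioo a b)
    (hA : ∀ t ∈ Ioo a b, HasDerivAt A (A' t) t)
    (hA' : ∀ t ∈ Ioo a b, HasDerivAt A' (-(R t * A t)) t)
    (hR : ∀ t ∈ Ioo a b, (R t).IsSymm) (hRc : ContinuousAt R 0)
    (hA0 : A 0 = 0) (hA'0 : A' 0 = 1)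
    (hdet : ∀ t ∈ Ioo 0 b, (A t).det ≠ 0)
    (hRic : ∀ t ∈ Ioo 0 b, 0 ≤ (R t).trace) :
    ∀ t ∈ Ioo 0 b, (A t).det ≤ t ^ Fintype.card ι := by
  rcases isEmpty_or_nonempty ι with hι | hι
  · intro t _
    simp [Matrix.det_isEmpty]
  · exact jacobi_det_le_pow h0 hA hA' hR hRc hA0 hA'0 hdet hRic

/-- **Bishop's inequality (III.4.13) for the polar density, `Ric ≥ -(d-1)`** (Chavel 2006,
Thm. III.4.3: `det 𝒜(t;ξ) ≤ S_κ^{n-1}(t)`, `κ = -1`): in exponential polar coordinates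
`F = exp_p ∘ L`, along every ray and for every `t > 0`,
`(𝟙_W 𝒥)(tθ) t^{d-1} ≤ sinh^{d-1}(t)` (inside `W` by `exists_jacobi_sqrt_det_gram_expMap_ray`
and the matrix Riccati comparison `jacobi_det_le_sinh_pow`; `0` outside).
[cite: Chavel2006, §III.4, Thm. III.4.3 (III.4.13)] -/
theorem indicator_jacobian_mul_pow_le_sinh_pow [ConnectedSpace M] (hg : g.IsRiemannian)
    (hc : IsGeodesicallyComplete g.leviCivita)
    (hRic : ∀ (x : M) (w : TangentSpace 𝓘(ℝ, (EuclideanSpace ℝ (Fin d))) x),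
      -((d : ℝ) - 1) * g.val x w w ≤ g.leviCivita.ricci x w w)
    (p : M) (L : (EuclideanSpace ℝ (Fin d)) ≃L[ℝ] (EuclideanSpace ℝ (Fin d)))
    (hL : ∀ x y : (EuclideanSpace ℝ (Fin d)), g.val p (L x) (L y) = inner ℝ x y)
    (θ : (EuclideanSpace ℝ (Fin d))) (hθ : ‖θ‖ = 1) {t : ℝ} (ht : 0 < t) :
    {x : EuclideanSpace ℝ (Fin d) |
        (show TangentSpace 𝓘(ℝ, (EuclideanSpace ℝ (Fin d))) p from L x) ∈
          injectivityDomain g hg p}.indicator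
        (fun z ↦ ENNReal.ofReal (Real.sqrt (Matrix.of fun i j : Fin d ↦
          g.val (expMap g.leviCivita p (L z))
            (mfderiv 𝓘(ℝ, (EuclideanSpace ℝ (Fin d))) 𝓘(ℝ, (EuclideanSpace ℝ (Fin d)))
              (fun x : (EuclideanSpace ℝ (Fin d)) ↦ expMap g.leviCivita p (L x)) z
              (EuclideanSpace.single i 1))
            (mfderiv 𝓘(ℝ, (EuclideanSpace ℝ (Fin d))) 𝓘(ℝ, (EuclideanSpace ℝ (Fin d)))
              (fun x : (EuclideanSpace ℝ (Fin d)) ↦ expMap g.leviCivita p (L x)) z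
              (EuclideanSpace.single j 1))).det)) (t • θ) * ENNReal.ofReal (t ^ (d - 1)) ≤
      ENNReal.ofReal (Real.sinh t ^ (d - 1)) := by
  classical
  haveI : Fact ((1 : ℕ∞ω) ≤ ((⊤ : ℕ∞) : ℕ∞ω)) := ⟨by exact_mod_cast le_top⟩
  set W : Set (EuclideanSpace ℝ (Fin d)) := {x | (show TangentSpace 𝓘(ℝ, (EuclideanSpace ℝ (Fin d))) p
    from L x) ∈ injectivityDomain g hg p} with hW_def
  by_cases htW : t • θ ∈ W
  · rw [indicator_of_mem htW]
    obtain ⟨s', hs', hmin⟩ := htW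
    have hmin' : IsMinimizingUpTo g hg p
        (show TangentSpace 𝓘(ℝ, (EuclideanSpace ℝ (Fin d))) p from
          (L θ : (EuclideanSpace ℝ (Fin d)))) (t * s') := by
      refine (isMinimizingUpTo_smul_iff hg hc p _ ht s').1 ?_
      have key : ∀ w w' : (EuclideanSpace ℝ (Fin d)), w = w' →
          IsMinimizingUpTo g hg p (show TangentSpace 𝓘(ℝ, (EuclideanSpace ℝ (Fin d))) p from w) s' →
          IsMinimizingUpTo g hg p (show TangentSpace 𝓘(ℝ, (EuclideanSpace ℝ (Fin d))) p from w') s' := by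
        rintro w w' rfl h'
        exact h'
      exact key _ _ (L.map_smul t θ) hmin
    have hb : 0 < t * s' := mul_pos ht (zero_lt_one.trans hs')
    have htb : t < t * s' := lt_mul_of_one_lt_right ht hs'
    obtain ⟨k, A, A₁, R, hkd, hA, hA', hR, hRc, hA0, hA'0, hunit, hdet, hkey⟩ :=
      exists_jacobi_sqrt_det_gram_expMap_ray g hg hc p L hL θ hθ hb
    have hdk : d - 1 = k := by omega
    have h0 : (0 : ℝ) ∈ Ioo (-1 : ℝ) (t * s') := ⟨by norm_num, hb⟩
    have hdet' : ∀ τ ∈ Ioo 0 (t * s'), (A τ).det ≠ 0 := by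
      intro τ hτ
      refine hdet τ hτ ?_
      have hmem : (show TangentSpace 𝓘(ℝ, (EuclideanSpace ℝ (Fin d))) p from
          τ • (L θ : (EuclideanSpace ℝ (Fin d)))) ∈ injectivityDomain g hg p := by
        refine ⟨t * s' / τ, by rw [lt_div_iff₀ hτ.1, one_mul]; exact hτ.2, ?_⟩
        exact (isMinimizingUpTo_smul_iff hg hc p
          (show TangentSpace 𝓘(ℝ, (EuclideanSpace ℝ (Fin d))) p from
            (L θ : (EuclideanSpace ℝ (Fin d)))) hτ.1 (t * s' / τ)).2
          (by rw [mul_div_cancel₀ _ hτ.1.ne']; exact hmin')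
      exact mfderiv_riemannianExpMap_injective_of_mem_injectivityDomain g le_rfl hg hc p hmem
    have hpos : ∀ τ ∈ Ioo 0 (t * s'), 0 < (A τ).det := jacobi_det_pos h0 hA hA0 hA'0 hdet'
    have hRic' : ∀ τ ∈ Ioo 0 (t * s'), -(Fintype.card (Fin k) : ℝ) ≤ (R τ).trace := by
      intro τ hτ
      have hτ' : τ ∈ Ioo (-1 : ℝ) (t * s') := ⟨by linarith [hτ.1], hτ.2⟩
      rw [Fintype.card_fin, (hunit τ hτ').2]
      have h := hRic _ (velocity 𝓘(ℝ, EuclideanSpace ℝ (Fin d))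
        (maximalGeodesic g.leviCivita p (L θ : EuclideanSpace ℝ (Fin d))) τ)
      rw [(hunit τ hτ').1, mul_one] at h
      have hkd' : ((d : ℝ) - 1) = k := by
        rw [← hkd]; push_cast; ring
      rw [hkd'] at h
      exact h
    have hle := jacobi_det_le_sinh_pow' h0 hA hA' hR hRc hA0 hA'0 hdet' hRic' t ⟨ht, htb⟩
    rw [Fintype.card_fin] at hle
    rw [← ENNReal.ofReal_mul (Real.sqrt_nonneg _), hkey t ⟨ht, htb⟩, hdk, abs_of_pos (hpos t ⟨ht, htb⟩),
      div_mul_cancel₀ _ (pow_ne_zero _ ht.ne')]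
    exact ENNReal.ofReal_le_ofReal hle
  · rw [indicator_of_notMem htW, zero_mul]
    exact zero_le

/-- **Bishop's inequality (III.4.13) for the polar density, `Ric ≥ 0`**: along every ray and for
every `t > 0`, `(𝟙_W 𝒥)(tθ) ≤ 1` (`det 𝒜(t) ≤ t^{d-1}`, `jacobi_det_le_pow`).
[cite: Chavel2006, §III.4, Thm. III.4.3 (III.4.13)] -/
theorem indicator_jacobian_le_one [ConnectedSpace M] (hg : g.IsRiemannian)
    (hc : IsGeodesicallyComplete g.leviCivita)
    (hRic : ∀ (x : M) (w : TangentSpace 𝓘(ℝ, (EuclideanSpace ℝ (Fin d))) x),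
      0 ≤ g.leviCivita.ricci x w w)
    (p : M) (L : (EuclideanSpace ℝ (Fin d)) ≃L[ℝ] (EuclideanSpace ℝ (Fin d)))
    (hL : ∀ x y : (EuclideanSpace ℝ (Fin d)), g.val p (L x) (L y) = inner ℝ x y)
    (θ : (EuclideanSpace ℝ (Fin d))) (hθ : ‖θ‖ = 1) {t : ℝ} (ht : 0 < t) :
    {x : EuclideanSpace ℝ (Fin d) |
        (show TangentSpace 𝓘(ℝ, (EuclideanSpace ℝ (Fin d))) p from L x) ∈
          injectivityDomain g hg p}.indicator
        (fun z ↦ ENNReal.ofReal (Real.sqrt (Matrix.of fun i j : Fin d ↦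
          g.val (expMap g.leviCivita p (L z))
            (mfderiv 𝓘(ℝ, (EuclideanSpace ℝ (Fin d))) 𝓘(ℝ, (EuclideanSpace ℝ (Fin d)))
              (fun x : (EuclideanSpace ℝ (Fin d)) ↦ expMap g.leviCivita p (L x)) z
              (EuclideanSpace.single i 1))
            (mfderiv 𝓘(ℝ, (EuclideanSpace ℝ (Fin d))) 𝓘(ℝ, (EuclideanSpace ℝ (Fin d)))
              (fun x : (EuclideanSpace ℝ (Fin d)) ↦ expMap g.leviCivita p (L x)) z
              (EuclideanSpace.single j 1))).det)) (t • θ) ≤ 1 := by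
  classical
  haveI : Fact ((1 : ℕ∞ω) ≤ ((⊤ : ℕ∞) : ℕ∞ω)) := ⟨by exact_mod_cast le_top⟩
  set W : Set (EuclideanSpace ℝ (Fin d)) := {x | (show TangentSpace 𝓘(ℝ, (EuclideanSpace ℝ (Fin d))) p
    from L x) ∈ injectivityDomain g hg p} with hW_def
  by_cases htW : t • θ ∈ W
  · rw [indicator_of_mem htW]
    obtain ⟨s', hs', hmin⟩ := htW
    have hmin' : IsMinimizingUpTo g hg p
        (show TangentSpace 𝓘(ℝ, (EuclideanSpace ℝ (Fin d))) p from
          (L θ : (EuclideanSpace ℝ (Fin d)))) (t * s') := by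
      refine (isMinimizingUpTo_smul_iff hg hc p _ ht s').1 ?_
      have key : ∀ w w' : (EuclideanSpace ℝ (Fin d)), w = w' →
          IsMinimizingUpTo g hg p (show TangentSpace 𝓘(ℝ, (EuclideanSpace ℝ (Fin d))) p from w) s' →
          IsMinimizingUpTo g hg p (show TangentSpace 𝓘(ℝ, (EuclideanSpace ℝ (Fin d))) p from w') s' := by
        rintro w w' rfl h'
        exact h'
      exact key _ _ (L.map_smul t θ) hmin
    have hb : 0 < t * s' := mul_pos ht (zero_lt_one.trans hs')
    have htb : t < t * s' := lt_mul_of_one_lt_right ht hs'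
    obtain ⟨k, A, A₁, R, hkd, hA, hA', hR, hRc, hA0, hA'0, hunit, hdet, hkey⟩ :=
      exists_jacobi_sqrt_det_gram_expMap_ray g hg hc p L hL θ hθ hb
    have h0 : (0 : ℝ) ∈ Ioo (-1 : ℝ) (t * s') := ⟨by norm_num, hb⟩
    have hdet' : ∀ τ ∈ Ioo 0 (t * s'), (A τ).det ≠ 0 := by
      intro τ hτ
      refine hdet τ hτ ?_
      have hmem : (show TangentSpace 𝓘(ℝ, (EuclideanSpace ℝ (Fin d))) p from
          τ • (L θ : (EuclideanSpace ℝ (Fin d)))) ∈ injectivityDomain g hg p := by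
        refine ⟨t * s' / τ, by rw [lt_div_iff₀ hτ.1, one_mul]; exact hτ.2, ?_⟩
        exact (isMinimizingUpTo_smul_iff hg hc p
          (show TangentSpace 𝓘(ℝ, (EuclideanSpace ℝ (Fin d))) p from
            (L θ : (EuclideanSpace ℝ (Fin d)))) hτ.1 (t * s' / τ)).2
          (by rw [mul_div_cancel₀ _ hτ.1.ne']; exact hmin')
      exact mfderiv_riemannianExpMap_injective_of_mem_injectivityDomain g le_rfl hg hc p hmem
    have hpos : ∀ τ ∈ Ioo 0 (t * s'), 0 < (A τ).det := jacobi_det_pos h0 hA hA0 hA'0 hdet'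
    have hRic' : ∀ τ ∈ Ioo 0 (t * s'), 0 ≤ (R τ).trace := by
      intro τ hτ
      have hτ' : τ ∈ Ioo (-1 : ℝ) (t * s') := ⟨by linarith [hτ.1], hτ.2⟩
      rw [(hunit τ hτ').2]
      exact hRic _ _
    have hle := jacobi_det_le_pow' h0 hA hA' hR hRc hA0 hA'0 hdet' hRic' t ⟨ht, htb⟩
    rw [Fintype.card_fin] at hle
    rw [hkey t ⟨ht, htb⟩, abs_of_pos (hpos t ⟨ht, htb⟩), ← ENNReal.ofReal_one]
    exact ENNReal.ofReal_le_ofReal ((div_le_one (pow_pos ht _)).2 hle)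
  · rw [indicator_of_notMem htW]
    exact zero_le

/-- **Bishop's volume comparison for balls, `Ric ≥ -(d-1)`** (Chavel 2006, Thm. III.4.4,
(III.4.21) `V(x; r) ≤ V_κ(r)`, `κ = -1`; the upper bound complementing (0.5)): on a connected
Riemannian `d`-manifold (`d ≥ 1`) with geodesically complete Levi-Civita connection and
`Ric ≥ -(d-1) g`, `Vol {d(p,·) < r} ≤ |S^{d-1}| ∫₀ʳ sinh^{d-1}` (`= V₋₁(r)`, the volume of the
ball of radius `r` in hyperbolic space) for `r > 0`: exponential polar coordinates
(`riemannianMeasure_ball_eq_setLIntegral_indicator`, `setLIntegral_ball_eq_lintegral_sphere`),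
Bishop's inequality `indicator_jacobian_mul_pow_le_sinh_pow` on each ray, and
`|S^{d-1}| = volume.toSphere(S^{d-1})` (`toSphere_volume_univ`).
[cite: Chavel2006, §III.4, Thm. III.4.4 (III.4.21)] -/
theorem riemannianMeasure_ball_le_of_ricci_ge_neg (hd : 0 < d) [ConnectedSpace M]
    [T3Space M] [MeasurableSpace M] [BorelSpace M] (hg : g.IsRiemannian)
    (hc : IsGeodesicallyComplete g.leviCivita)
    (hRic : ∀ (x : M) (w : TangentSpace 𝓘(ℝ, (EuclideanSpace ℝ (Fin d))) x),
      -((d : ℝ) - 1) * g.val x w w ≤ g.leviCivita.ricci x w w)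
    (p : M) {r : ℝ} (hr : 0 < r) :
    riemannianMeasure (I := 𝓘(ℝ, (EuclideanSpace ℝ (Fin d)))) (g.toContMDiffRiemannianMetric hg)
        {y : M | g.edist hg p y < ENNReal.ofReal r} ≤
      ENNReal.ofReal (unitSphereVolume (d - 1) * ∫ t in (0 : ℝ)..r, Real.sinh t ^ (d - 1)) := by
  classical
  haveI : Fact ((1 : ℕ∞ω) ≤ ((⊤ : ℕ∞) : ℕ∞ω)) := ⟨by exact_mod_cast le_top⟩
  obtain ⟨k, rfl⟩ : ∃ k, d = k + 1 := ⟨d - 1, by omega⟩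
  obtain ⟨L, hL⟩ := exists_linearIsometry_tangentSpace g hg p
  set h := g.toContMDiffRiemannianMetric hg with hh_def
  set Φ : (EuclideanSpace ℝ (Fin (k + 1))) → M := fun x ↦ expMap g.leviCivita p (L x) with hΦ_def
  have hΦs : ContMDiff 𝓘(ℝ, (EuclideanSpace ℝ (Fin (k + 1)))) 𝓘(ℝ, (EuclideanSpace ℝ (Fin (k + 1)))) 1 Φ :=
    ((contMDiff_expMap_infty hc p).of_le (by exact_mod_cast le_top)).comp
      L.toContinuousLinearMap.contDiff.contMDiff
  set Jac : (EuclideanSpace ℝ (Fin (k + 1))) → ℝ≥0∞ := fun z ↦ ENNReal.ofReal (Real.sqrt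
    (Matrix.of fun i j : Fin (k + 1) ↦ g.val (Φ z)
      (mfderiv 𝓘(ℝ, (EuclideanSpace ℝ (Fin (k + 1)))) 𝓘(ℝ, (EuclideanSpace ℝ (Fin (k + 1)))) Φ z
        (EuclideanSpace.single i 1))
      (mfderiv 𝓘(ℝ, (EuclideanSpace ℝ (Fin (k + 1)))) 𝓘(ℝ, (EuclideanSpace ℝ (Fin (k + 1)))) Φ z
        (EuclideanSpace.single j 1))).det) with hJac_def
  have hJac_meas : Measurable Jac :=
    ENNReal.measurable_ofReal.comp (continuous_sqrt_det_inner_mfderiv h hΦs).measurable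
  set W : Set (EuclideanSpace ℝ (Fin (k + 1))) :=
    {x | (show TangentSpace 𝓘(ℝ, (EuclideanSpace ℝ (Fin (k + 1)))) p from L x) ∈
      injectivityDomain g hg p} with hW_def
  have hWo : IsOpen W :=
    (isOpen_injectivityDomain_of_isGeodesicallyComplete g le_rfl hg hc p).preimage L.continuous
  have hWm : MeasurableSet W := hWo.measurableSet
  rw [riemannianMeasure_ball_eq_setLIntegral_indicator g hd hg hc p L hL r]
  show ∫⁻ x in Metric.ball (0 : EuclideanSpace ℝ (Fin (k + 1))) r, W.indicator Jac x ≤ _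
  rw [setLIntegral_ball_eq_lintegral_sphere hd (hJac_meas.indicator hWm) r, Nat.add_sub_cancel,
    ENNReal.ofReal_mul (unitSphereVolume_pos k).le, ← toSphere_volume_univ k,
    ← setLIntegral_Ioo_sinh_pow_eq_ofReal k hr.le,
    mul_comm (((volume : Measure (EuclideanSpace ℝ (Fin (k + 1)))).toSphere) univ), ← lintegral_const]
  refine lintegral_mono fun θ ↦ ?_
  refine lintegral_mono_ae (ae_restrict_of_forall_mem measurableSet_Ioo fun t ht ↦ ?_)
  have hθ : ‖(θ : (EuclideanSpace ℝ (Fin (k + 1))))‖ = 1 := mem_sphere_zero_iff_norm.1 θ.2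
  have key := indicator_jacobian_mul_pow_le_sinh_pow g hg hc hRic p L hL θ hθ ht.1
  rw [Nat.add_sub_cancel] at key
  exact key

/-- **Bishop's volume comparison for balls, `Ric ≥ 0`** (Chavel 2006, Thm. III.4.4 with `κ = 0`;
Bishop 1964): with `Ric ≥ 0`, `Vol {d(p,·) < r} ≤ |S^{d-1}| rᵈ/d`, the volume of the Euclidean
ball of radius `r` (`indicator_jacobian_le_one` on each ray).
[cite: Chavel2006, §III.4, Thm. III.4.4 (III.4.21)] -/
theorem riemannianMeasure_ball_le_of_ricci_nonneg (hd : 0 < d) [ConnectedSpace M]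
    [T3Space M] [MeasurableSpace M] [BorelSpace M] (hg : g.IsRiemannian)
    (hc : IsGeodesicallyComplete g.leviCivita)
    (hRic : ∀ (x : M) (w : TangentSpace 𝓘(ℝ, (EuclideanSpace ℝ (Fin d))) x),
      0 ≤ g.leviCivita.ricci x w w)
    (p : M) {r : ℝ} (hr : 0 < r) :
    riemannianMeasure (I := 𝓘(ℝ, (EuclideanSpace ℝ (Fin d)))) (g.toContMDiffRiemannianMetric hg)
        {y : M | g.edist hg p y < ENNReal.ofReal r} ≤
      ENNReal.ofReal (unitSphereVolume (d - 1) * (r ^ d / d)) := by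
  classical
  haveI : Fact ((1 : ℕ∞ω) ≤ ((⊤ : ℕ∞) : ℕ∞ω)) := ⟨by exact_mod_cast le_top⟩
  obtain ⟨k, rfl⟩ : ∃ k, d = k + 1 := ⟨d - 1, by omega⟩
  obtain ⟨L, hL⟩ := exists_linearIsometry_tangentSpace g hg p
  set h := g.toContMDiffRiemannianMetric hg with hh_def
  set Φ : (EuclideanSpace ℝ (Fin (k + 1))) → M := fun x ↦ expMap g.leviCivita p (L x) with hΦ_def
  have hΦs : ContMDiff 𝓘(ℝ, (EuclideanSpace ℝ (Fin (k + 1)))) 𝓘(ℝ, (EuclideanSpace ℝ (Fin (k + 1)))) 1 Φ :=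
    ((contMDiff_expMap_infty hc p).of_le (by exact_mod_cast le_top)).comp
      L.toContinuousLinearMap.contDiff.contMDiff
  set Jac : (EuclideanSpace ℝ (Fin (k + 1))) → ℝ≥0∞ := fun z ↦ ENNReal.ofReal (Real.sqrt
    (Matrix.of fun i j : Fin (k + 1) ↦ g.val (Φ z)
      (mfderiv 𝓘(ℝ, (EuclideanSpace ℝ (Fin (k + 1)))) 𝓘(ℝ, (EuclideanSpace ℝ (Fin (k + 1)))) Φ z
        (EuclideanSpace.single i 1))
      (mfderiv 𝓘(ℝ, (EuclideanSpace ℝ (Fin (k + 1)))) 𝓘(ℝ, (EuclideanSpace ℝ (Fin (k + 1)))) Φ z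
        (EuclideanSpace.single j 1))).det) with hJac_def
  have hJac_meas : Measurable Jac :=
    ENNReal.measurable_ofReal.comp (continuous_sqrt_det_inner_mfderiv h hΦs).measurable
  set W : Set (EuclideanSpace ℝ (Fin (k + 1))) :=
    {x | (show TangentSpace 𝓘(ℝ, (EuclideanSpace ℝ (Fin (k + 1)))) p from L x) ∈
      injectivityDomain g hg p} with hW_def
  have hWo : IsOpen W :=
    (isOpen_injectivityDomain_of_isGeodesicallyComplete g le_rfl hg hc p).preimage L.continuous
  have hWm : MeasurableSet W := hWo.measurableSet
  have hpow : ∫⁻ t in Ioo 0 r, ENNReal.ofReal (t ^ k) = ENNReal.ofReal (r ^ (k + 1) / (k + 1)) := by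
    rw [setLIntegral_Ioo_pow_eq_ofReal k hr.le, integral_pow]
    congr 1
    rw [zero_pow (Nat.succ_ne_zero k), sub_zero]
  rw [riemannianMeasure_ball_eq_setLIntegral_indicator g hd hg hc p L hL r]
  show ∫⁻ x in Metric.ball (0 : EuclideanSpace ℝ (Fin (k + 1))) r, W.indicator Jac x ≤ _
  rw [setLIntegral_ball_eq_lintegral_sphere hd (hJac_meas.indicator hWm) r, Nat.add_sub_cancel,
    ENNReal.ofReal_mul (unitSphereVolume_pos k).le, ← toSphere_volume_univ k, Nat.cast_succ,
    ← hpow, mul_comm (((volume : Measure (EuclideanSpace ℝ (Fin (k + 1)))).toSphere) univ),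
    ← lintegral_const]
  refine lintegral_mono fun θ ↦ ?_
  refine lintegral_mono_ae (ae_restrict_of_forall_mem measurableSet_Ioo fun t ht ↦ ?_)
  have hθ : ‖(θ : (EuclideanSpace ℝ (Fin (k + 1))))‖ = 1 := mem_sphere_zero_iff_norm.1 θ.2
  have key := indicator_jacobian_le_one g hg hc hRic p L hL θ hθ ht.1
  calc _ ≤ 1 * ENNReal.ofReal (t ^ k) := mul_le_mul' key le_rfl
    _ = ENNReal.ofReal (t ^ k) := one_mul _

/-- **Distance spheres are null sets** (the level sets `{d(p,·) = r}` of the distance function of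
a complete Riemannian manifold have measure zero; Chavel 2006, §III.3/III.5: the volume is
computed inside the domain of polar coordinates, spheres in `T_pM` being Lebesgue-null): in the
notation of `expPolar_data`, `{d(p,·) = r} ⊆ F(W ∩ {|x| = r}) ∪ F(N)` with
`Vol F(W ∩ {|x| = r}) = ∫_{W ∩ {|x| = r}} 𝒥 = 0` (`Measure.addHaar_sphere`) and `Vol F(N) = 0`.
[cite: Chavel2006, §III.3, (III.3.5)] -/
theorem riemannianMeasure_sphere_eq_zero (hd : 0 < d) [ConnectedSpace M]
    [T3Space M] [MeasurableSpace M] [BorelSpace M] (hg : g.IsRiemannian)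
    (hc : IsGeodesicallyComplete g.leviCivita) (p : M) (r : ℝ) :
    riemannianMeasure (I := 𝓘(ℝ, (EuclideanSpace ℝ (Fin d)))) (g.toContMDiffRiemannianMetric hg)
        {y : M | g.edist hg p y = ENNReal.ofReal r} = 0 := by
  classical
  haveI : Nontrivial (EuclideanSpace ℝ (Fin d)) := by
    have : 0 < Module.finrank ℝ (EuclideanSpace ℝ (Fin d)) := by
      rw [finrank_euclideanSpace_fin]; exact hd
    exact Module.finrank_pos_iff.1 this
  obtain ⟨L, hL⟩ := exists_linearIsometry_tangentSpace g hg p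
  obtain ⟨-, harea, ⟨N, -, -, hΦN, hpolar⟩, -⟩ := expPolar_data g hd hg hc p L hL
  set Φ : (EuclideanSpace ℝ (Fin d)) → M := fun x ↦ expMap g.leviCivita p (L x) with hΦ_def
  set W : Set (EuclideanSpace ℝ (Fin d)) := {x | (show TangentSpace 𝓘(ℝ, (EuclideanSpace ℝ (Fin d))) p
    from L x) ∈ injectivityDomain g hg p} with hW_def
  have hWm : MeasurableSet W :=
    ((isOpen_injectivityDomain_of_isGeodesicallyComplete g le_rfl hg hc p).preimage
      L.continuous).measurableSet
  -- the radius `|r|⁺`: `ofReal r = ofReal (max r 0)`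
  set ρ : ℝ := max r 0 with hρ
  have hρr : ENNReal.ofReal r = ENNReal.ofReal ρ := by
    rcases le_total r 0 with h | h
    · rw [hρ, max_eq_right h, ENNReal.ofReal_of_nonpos h, ENNReal.ofReal_zero]
    · rw [hρ, max_eq_left h]
  have hρ0 : 0 ≤ ρ := le_max_right _ _
  set S : Set (EuclideanSpace ℝ (Fin d)) := Metric.sphere (0 : EuclideanSpace ℝ (Fin d)) ρ with hS
  have hSm : MeasurableSet S := Metric.isClosed_sphere.measurableSet
  have hcover : {y : M | g.edist hg p y = ENNReal.ofReal r} ⊆ Φ '' (W ∩ S) ∪ Φ '' N := by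
    intro y hy
    obtain ⟨x, hxy, hnx, -, hxWN⟩ := hpolar y
    have hy' : g.edist hg p y = ENNReal.ofReal r := hy
    have hxS : x ∈ S := by
      rw [hS, mem_sphere_zero_iff_norm]
      have h1 : ENNReal.ofReal ‖x‖ = ENNReal.ofReal ρ := by rw [hnx, hy', hρr]
      have h2 := congrArg ENNReal.toReal h1
      rwa [ENNReal.toReal_ofReal (norm_nonneg _), ENNReal.toReal_ofReal hρ0] at h2
    rcases hxWN with hxW | hxN
    · exact Or.inl ⟨x, ⟨hxW, hxS⟩, hxy⟩
    · exact Or.inr ⟨x, hxN, hxy⟩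
  refine le_antisymm ?_ zero_le
  calc riemannianMeasure (I := 𝓘(ℝ, (EuclideanSpace ℝ (Fin d)))) (g.toContMDiffRiemannianMetric hg)
        {y : M | g.edist hg p y = ENNReal.ofReal r}
      ≤ riemannianMeasure (I := 𝓘(ℝ, (EuclideanSpace ℝ (Fin d)))) (g.toContMDiffRiemannianMetric hg)
          (Φ '' (W ∩ S)) +
        riemannianMeasure (I := 𝓘(ℝ, (EuclideanSpace ℝ (Fin d)))) (g.toContMDiffRiemannianMetric hg)
          (Φ '' N) := (measure_mono hcover).trans (measure_union_le _ _)
    _ = 0 := by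
        rw [hΦN, add_zero, harea _ (hWm.inter hSm) inter_subset_left]
        exact setLIntegral_measure_zero _ _
          (measure_mono_null inter_subset_right (Measure.addHaar_sphere volume _ _))

/-- **Closed and open distance balls have the same volume**: `Vol {d(p,·) ≤ r} = Vol {d(p,·) < r}`
(the sphere `{d(p,·) = r}` is null, `riemannianMeasure_sphere_eq_zero`). [folklore] -/
theorem riemannianMeasure_closedBall_eq_ball (hd : 0 < d) [ConnectedSpace M]
    [T3Space M] [MeasurableSpace M] [BorelSpace M] (hg : g.IsRiemannian)
    (hc : IsGeodesicallyComplete g.leviCivita) (p : M) (r : ℝ) :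
    riemannianMeasure (I := 𝓘(ℝ, (EuclideanSpace ℝ (Fin d)))) (g.toContMDiffRiemannianMetric hg)
        {y : M | g.edist hg p y ≤ ENNReal.ofReal r} =
      riemannianMeasure (I := 𝓘(ℝ, (EuclideanSpace ℝ (Fin d)))) (g.toContMDiffRiemannianMetric hg)
        {y : M | g.edist hg p y < ENNReal.ofReal r} := by
  have hsplit : {y : M | g.edist hg p y ≤ ENNReal.ofReal r} =
      {y : M | g.edist hg p y < ENNReal.ofReal r} ∪ {y : M | g.edist hg p y = ENNReal.ofReal r} := by
    ext y
    simp only [mem_setOf_eq, mem_union]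
    exact le_iff_lt_or_eq
  have hzero := riemannianMeasure_sphere_eq_zero g hd hg hc p r
  rw [hsplit]
  refine le_antisymm ((measure_union_le _ _).trans ?_) (measure_mono subset_union_left)
  rw [hzero, add_zero]

end BallBounds

/-! ### Two-centre relative volume comparison ((1.2)–(1.4) of Cheeger–Colding 1997) -/

section TwoCentre

variable {d : ℕ} {M : Type*} [TopologicalSpace M] [ChartedSpace (EuclideanSpace ℝ (Fin d)) M]
  [IsManifold 𝓘(ℝ, EuclideanSpace ℝ (Fin d)) ∞ M] [T2Space M]
  (g : PseudoRiemannianMetric 𝓘(ℝ, EuclideanSpace ℝ (Fin d)) ∞ (EuclideanSpace ℝ (Fin d))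
    (TangentSpace 𝓘(ℝ, EuclideanSpace ℝ (Fin d)) : M → Type _)) [g.HasLeviCivita]

omit [T2Space M] [g.HasLeviCivita] in
/-- Balls about nearby centres are nested: if `d(x₁, x₂) ≤ s` then
`B_{r}(x₂) ⊆ B_{r + s}(x₁)` (`0 ≤ r, s`; triangle inequality for `d_g`). [folklore] -/
theorem setOf_edist_lt_subset_of_edist_le (hg : g.IsRiemannian) {x₁ x₂ : M} {s r : ℝ}
    (hs : 0 ≤ s) (hr : 0 ≤ r) (h12 : g.edist hg x₁ x₂ ≤ ENNReal.ofReal s) :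
    {y : M | g.edist hg x₂ y < ENNReal.ofReal r} ⊆
      {y : M | g.edist hg x₁ y < ENNReal.ofReal (r + s)} := by
  intro y hy
  have hy' : g.edist hg x₂ y < ENNReal.ofReal r := hy
  show g.edist hg x₁ y < ENNReal.ofReal (r + s)
  calc g.edist hg x₁ y ≤ g.edist hg x₁ x₂ + g.edist hg x₂ y := g.edist_triangle hg x₁ x₂ y
    _ < ENNReal.ofReal s + ENNReal.ofReal r :=
        ENNReal.add_lt_add_of_le_of_lt (ne_top_of_le_ne_top ENNReal.ofReal_ne_top h12) h12 hy'
    _ = ENNReal.ofReal (r + s) := by rw [← ENNReal.ofReal_add hs hr, add_comm]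

omit [T2Space M] [g.HasLeviCivita] in
/-- **(1.4) of Cheeger–Colding 1997**: for `d(x₁, x₂) ≤ s` and `r₁ + s ≤ r₂`,
`Vol B_{r₁}(x₁) ≤ Vol B_{r₂}(x₂)` (containment; no curvature hypothesis; `0 ≤ r₁, s`).
[cite: CheegerColding1997, §1 (1.4) (p. 415)] -/
theorem riemannianMeasure_ball_le_ball_of_edist_le (hg : g.IsRiemannian) [MeasurableSpace M]
    (μ : Measure M) {x₁ x₂ : M} {s r₁ r₂ : ℝ} (hs : 0 ≤ s) (hr₁ : 0 ≤ r₁) (h : r₁ + s ≤ r₂)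
    (h12 : g.edist hg x₁ x₂ ≤ ENNReal.ofReal s) :
    μ {y : M | g.edist hg x₁ y < ENNReal.ofReal r₁} ≤ μ {y : M | g.edist hg x₂ y < ENNReal.ofReal r₂} := by
  refine measure_mono ((setOf_edist_lt_subset_of_edist_le g hg hs hr₁
    (by rwa [g.edist_comm hg])).trans fun y hy ↦ ?_)
  have hy' : g.edist hg x₂ y < ENNReal.ofReal (r₁ + s) := hy
  show g.edist hg x₂ y < ENNReal.ofReal r₂
  exact hy'.trans_le (ENNReal.ofReal_le_ofReal h)

variable [CovariantDerivative.ContMDiffCovariantDerivative g.leviCivita 1]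
  [CovariantDerivative.ContMDiffCovariantDerivative g.leviCivita ∞]

/-- **(1.2)/(1.3) of Cheeger–Colding 1997 — relative volume comparison for two centres**: on a
connected Riemannian `d`-manifold (`d ≥ 1`) with geodesically complete Levi-Civita connection and
`Ric ≥ -(d-1) g`, if `d(x₁, x₂) ≤ s` and `0 < r₁ ≤ r₂ + s` then
  `Vol B_{r₂}(x₂) · V(r₁) ≤ Vol B_{r₁}(x₁) · V(r₂ + s)`,  `V(ρ) = ∫₀^ρ sinh^{d-1}`
(printed: `Vol B_{r₁}(x₁)/Vol B_{r₂}(x₂) ≥ V_{n,-1}(r₁)/V_{n,-1}(r₂ + s)`; (1.3) is the same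
statement with the roles of the two balls exchanged) — (0.5) at the centre `x₁` between the radii
`r₁ ≤ r₂ + s` and the containment `B_{r₂}(x₂) ⊆ B_{r₂ + s}(x₁)`.
[cite: CheegerColding1997, §1 (1.2)–(1.3) (p. 415)] -/
theorem riemannianMeasure_ball_mul_le_of_ricci_ge_neg_of_edist_le (hd : 0 < d) [ConnectedSpace M]
    [T3Space M] [MeasurableSpace M] [BorelSpace M] (hg : g.IsRiemannian)
    (hc : IsGeodesicallyComplete g.leviCivita)
    (hRic : ∀ (x : M) (w : TangentSpace 𝓘(ℝ, (EuclideanSpace ℝ (Fin d))) x),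
      -((d : ℝ) - 1) * g.val x w w ≤ g.leviCivita.ricci x w w)
    {x₁ x₂ : M} {s r₁ r₂ : ℝ} (hs : 0 ≤ s) (hr₁ : 0 < r₁) (hr₂ : 0 ≤ r₂) (h : r₁ ≤ r₂ + s)
    (h12 : g.edist hg x₁ x₂ ≤ ENNReal.ofReal s) :
    riemannianMeasure (I := 𝓘(ℝ, (EuclideanSpace ℝ (Fin d)))) (g.toContMDiffRiemannianMetric hg)
        {y : M | g.edist hg x₂ y < ENNReal.ofReal r₂} *
        ENNReal.ofReal (∫ t in (0 : ℝ)..r₁, Real.sinh t ^ (d - 1)) ≤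
      riemannianMeasure (I := 𝓘(ℝ, (EuclideanSpace ℝ (Fin d)))) (g.toContMDiffRiemannianMetric hg)
        {y : M | g.edist hg x₁ y < ENNReal.ofReal r₁} *
        ENNReal.ofReal (∫ t in (0 : ℝ)..(r₂ + s), Real.sinh t ^ (d - 1)) := by
  have hsub := setOf_edist_lt_subset_of_edist_le g hg hs hr₂ h12
  calc riemannianMeasure (I := 𝓘(ℝ, (EuclideanSpace ℝ (Fin d)))) (g.toContMDiffRiemannianMetric hg)
          {y : M | g.edist hg x₂ y < ENNReal.ofReal r₂} *
          ENNReal.ofReal (∫ t in (0 : ℝ)..r₁, Real.sinh t ^ (d - 1))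
        ≤ riemannianMeasure (I := 𝓘(ℝ, (EuclideanSpace ℝ (Fin d))))
            (g.toContMDiffRiemannianMetric hg) {y : M | g.edist hg x₁ y < ENNReal.ofReal (r₂ + s)} *
          ENNReal.ofReal (∫ t in (0 : ℝ)..r₁, Real.sinh t ^ (d - 1)) :=
        mul_le_mul' (measure_mono hsub) le_rfl
    _ ≤ _ := riemannianMeasure_ball_mul_le_of_ricci_ge_neg g hd hg hc hRic x₁ hr₁ h

end TwoCentre

/-! ### The standard covering argument based on (0.5) on the manifold -/

section Covering

variable {d : ℕ} {M : Type*} [TopologicalSpace M] [ChartedSpace (EuclideanSpace ℝ (Fin d)) M]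
  [IsManifold 𝓘(ℝ, EuclideanSpace ℝ (Fin d)) ∞ M] [T2Space M]
  (g : PseudoRiemannianMetric 𝓘(ℝ, EuclideanSpace ℝ (Fin d)) ∞ (EuclideanSpace ℝ (Fin d))
    (TangentSpace 𝓘(ℝ, EuclideanSpace ℝ (Fin d)) : M → Type _)) [g.HasLeviCivita]
  [CovariantDerivative.ContMDiffCovariantDerivative g.leviCivita 1]
  [CovariantDerivative.ContMDiffCovariantDerivative g.leviCivita ∞]

/-- **Distance balls of a complete manifold with `Ric ≥ -(d-1)` have finite volume** (from
Bishop's bound `riemannianMeasure_ball_le_of_ricci_ge_neg`). [cite: Chavel2006, §III.4, Thm. III.4.4] -/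
theorem riemannianMeasure_ball_ne_top_of_ricci_ge_neg (hd : 0 < d) [ConnectedSpace M]
    [T3Space M] [MeasurableSpace M] [BorelSpace M] (hg : g.IsRiemannian)
    (hc : IsGeodesicallyComplete g.leviCivita)
    (hRic : ∀ (x : M) (w : TangentSpace 𝓘(ℝ, (EuclideanSpace ℝ (Fin d))) x),
      -((d : ℝ) - 1) * g.val x w w ≤ g.leviCivita.ricci x w w)
    (p : M) (r : ℝ) :
    riemannianMeasure (I := 𝓘(ℝ, (EuclideanSpace ℝ (Fin d)))) (g.toContMDiffRiemannianMetric hg)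
        {y : M | g.edist hg p y < ENNReal.ofReal r} ≠ ⊤ := by
  rcases le_or_gt r 0 with hr | hr
  · have hempty : {y : M | g.edist hg p y < ENNReal.ofReal r} = ∅ := by
      ext y
      simp [ENNReal.ofReal_of_nonpos hr]
    rw [hempty, measure_empty]
    exact ENNReal.zero_ne_top
  · exact ne_top_of_le_ne_top ENNReal.ofReal_ne_top
      (riemannianMeasure_ball_le_of_ricci_ge_neg g hd hg hc hRic p hr)

/-- **(0.5) in the metric-measure form on a complete manifold with `Ric ≥ -(d-1)`**: for the
metric space `(M, d_g)` (`g.metricSpace hg`) and `μ = vol_g`, for all centres `z` and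
`0 < r ≤ ρ`, `μ(B_ρ(z)) V(r) ≤ μ(B_r(z)) V(ρ)` with `V(ρ) = ∫₀^ρ sinh^{d-1}` (real numbers; balls
have finite volume by Bishop's bound) — the hypothesis `h05` of the covering and
renormalized-volume layers of `VolumeSphereTheoremProofs.lean` §10 and
`VolumeSphereTheoremReifenbergProofs.lean` §R4, §R6, now for complete manifolds
(cf. `measureReal_ball_mul_le_of_ricci_ge_neg` for closed ones).
[cite: CheegerColding1997, (0.5) (p. 410) and §1 (p. 415)] [cite: Chavel2006, §III.4, Thm. III.4.5] -/
theorem measureReal_ball_mul_le_of_ricci_ge_neg_of_complete (hd : 0 < d) [ConnectedSpace M]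
    [T3Space M] [MeasurableSpace M] [BorelSpace M] (hg : g.IsRiemannian)
    (hc : IsGeodesicallyComplete g.leviCivita)
    (hRic : ∀ (x : M) (w : TangentSpace 𝓘(ℝ, (EuclideanSpace ℝ (Fin d))) x),
      -((d : ℝ) - 1) * g.val x w w ≤ g.leviCivita.ricci x w w) :
    letI := g.metricSpace hg
    ∀ (z : M) (r ρ : ℝ), 0 < r → r ≤ ρ →
      (riemannianMeasure (I := 𝓘(ℝ, (EuclideanSpace ℝ (Fin d))))
          (g.toContMDiffRiemannianMetric hg)).real (Metric.ball z ρ) *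
          (∫ t in (0 : ℝ)..r, Real.sinh t ^ (d - 1)) ≤
        (riemannianMeasure (I := 𝓘(ℝ, (EuclideanSpace ℝ (Fin d))))
          (g.toContMDiffRiemannianMetric hg)).real (Metric.ball z r) *
          (∫ t in (0 : ℝ)..ρ, Real.sinh t ^ (d - 1)) := by
  letI := g.metricSpace hg
  intro z r ρ hr hrρ
  have key := riemannianMeasure_ball_mul_le_of_ricci_ge_neg g hd hg hc hRic z hr hrρ
  have hfin := riemannianMeasure_ball_ne_top_of_ricci_ge_neg g hd hg hc hRic z r
  rw [← PseudoRiemannianMetric.metricSpace_ball_eq hg z ρ] at key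
  rw [← PseudoRiemannianMetric.metricSpace_ball_eq hg z r] at key hfin
  have hI : ∀ ρ' : ℝ, 0 ≤ ρ' → 0 ≤ ∫ t in (0 : ℝ)..ρ', Real.sinh t ^ (d - 1) := fun ρ' hρ' ↦
    intervalIntegral.integral_nonneg hρ' fun t ht ↦ pow_nonneg (Real.sinh_nonneg_iff.2 ht.1) _
  have h1 := ENNReal.toReal_mono (ENNReal.mul_ne_top hfin ENNReal.ofReal_ne_top) key
  rw [ENNReal.toReal_mul, ENNReal.toReal_mul, ENNReal.toReal_ofReal (hI r hr.le),
    ENNReal.toReal_ofReal (hI ρ (hr.le.trans hrρ))] at h1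
  exact h1

/-- **The standard covering argument based on (0.5)** (Cheeger–Colding 1997, §1, p. 417,
(1.14)–(1.18): "by a standard covering argument based on (0.5), there are at most `N(n)`
balls …"; the `N(n, R, ε)` of Appendix 1, p. 462). On a connected Riemannian `d`-manifold
(`d ≥ 1`) with geodesically complete Levi-Civita connection and `Ric ≥ -(d-1) g`, for every
`x ∈ M`, `ε > 0` and `R ≥ 0` there is a finite `ε`-separated set `S ⊆ B_R(x)` with
`#S ≤ V(2R + ε/2)/V(ε/2)`, `V(ρ) = ∫₀^ρ sinh^{d-1}`, whose `ε`-balls cover `B_R(x)` — the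
abstract packing/covering lemma `exists_finset_cover_ball_of_relVolumeComparison`
(`VolumeSphereTheoremReifenbergProofs.lean` §R4) fed with (0.5)
(`measureReal_ball_mul_le_of_ricci_ge_neg_of_complete`), finiteness (Bishop) and positivity of
the volume of balls. [cite: CheegerColding1997, §1, (1.14)–(1.18) (p. 417)] -/
theorem exists_finset_cover_ball_of_ricci_ge_neg (hd : 0 < d) [ConnectedSpace M]
    [T3Space M] [MeasurableSpace M] [BorelSpace M] (hg : g.IsRiemannian)
    (hc : IsGeodesicallyComplete g.leviCivita)
    (hRic : ∀ (x : M) (w : TangentSpace 𝓘(ℝ, (EuclideanSpace ℝ (Fin d))) x),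
      -((d : ℝ) - 1) * g.val x w w ≤ g.leviCivita.ricci x w w)
    (x : M) {ε R : ℝ} (hε : 0 < ε) (hR : 0 ≤ R) :
    ∃ S : Finset M,
      (S.card : ℝ) ≤ (∫ t in (0 : ℝ)..(2 * R + ε / 2), Real.sinh t ^ (d - 1)) /
          ∫ t in (0 : ℝ)..(ε / 2), Real.sinh t ^ (d - 1) ∧
      (∀ y ∈ S, g.edist hg x y < ENNReal.ofReal R) ∧
      (∀ y ∈ S, ∀ y' ∈ S, y ≠ y' → ENNReal.ofReal ε ≤ g.edist hg y y') ∧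
      {z : M | g.edist hg x z < ENNReal.ofReal R} ⊆ ⋃ y ∈ S, {z : M | g.edist hg y z < ENNReal.ofReal ε} := by
  classical
  letI := g.metricSpace hg
  set vol : Measure M := riemannianMeasure (I := 𝓘(ℝ, (EuclideanSpace ℝ (Fin d))))
    (g.toContMDiffRiemannianMetric hg) with hvol
  set V : ℝ → ℝ := fun ρ ↦ ∫ t in (0 : ℝ)..ρ, Real.sinh t ^ (d - 1) with hV
  have hVpos : ∀ ρ, 0 < ρ → 0 < V ρ := fun ρ hρ ↦
    intervalIntegral.intervalIntegral_pos_of_pos_on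
      ((Real.continuous_sinh.pow _).intervalIntegrable 0 ρ)
      (fun t ht ↦ pow_pos (Real.sinh_pos_iff.2 ht.1) _) hρ
  have h05 : ∀ (z : M) (r ρ : ℝ), 0 < r → r ≤ ρ →
      vol.real (Metric.ball z ρ) * V r ≤ vol.real (Metric.ball z r) * V ρ :=
    measureReal_ball_mul_le_of_ricci_ge_neg_of_complete g hd hg hc hRic
  have hfin : ∀ (z : M) (ρ : ℝ), vol (Metric.ball z ρ) ≠ ⊤ := fun z ρ ↦ by
    rw [PseudoRiemannianMetric.metricSpace_ball_eq hg z ρ]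
    exact riemannianMeasure_ball_ne_top_of_ricci_ge_neg g hd hg hc hRic z ρ
  have hx : 0 < vol.real (Metric.ball x (R + ε / 2)) := by
    haveI := isOpenPosMeasure_riemannianMeasure (I := 𝓘(ℝ, (EuclideanSpace ℝ (Fin d))))
      (g.toContMDiffRiemannianMetric hg)
    have hpos : 0 < vol (Metric.ball x (R + ε / 2)) :=
      Metric.isOpen_ball.measure_pos vol ⟨x, Metric.mem_ball_self (by positivity)⟩
    exact ENNReal.toReal_pos hpos.ne' (hfin x _)
  obtain ⟨S, hcard, hS, hsep, hcov⟩ := exists_finset_cover_ball_of_relVolumeComparison vol h05 hfin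
    hε hR (hVpos _ (by positivity)) hx
  refine ⟨S, hcard, fun y hy ↦ ?_, fun y hy y' hy' hne ↦ ?_, fun z hz ↦ ?_⟩
  · have h := hS y hy
    rw [← Metric.mem_ball', PseudoRiemannianMetric.metricSpace_ball_eq hg x R] at h
    exact h
  · have h := hsep y hy y' hy' hne
    rw [PseudoRiemannianMetric.metricSpace_dist hg y y'] at h
    exact (ENNReal.ofReal_le_iff_le_toReal (PseudoRiemannianMetric.edist_ne_top hg y y')).2 h
  · have hz' : z ∈ Metric.ball x R := by
      rw [PseudoRiemannianMetric.metricSpace_ball_eq hg x R]; exact hz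
    have h := hcov hz'
    simp only [mem_iUnion] at h ⊢
    obtain ⟨y, hy, hzy⟩ := h
    refine ⟨y, hy, ?_⟩
    rw [PseudoRiemannianMetric.metricSpace_ball_eq hg y ε] at hzy
    exact hzy

end Covering

end Literature.Geometry.Riemannian
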